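import Summits.BirchSwinnertonDyer.BirchSwinnertonDyer.Theorems.ByReductionTypeAtTwoGoodOrdTowerCoinvKummer
import HarnessLib

/-!
# Route `ByReductionTypeAtTwo`, item `OrdKatoHalfAtTwo` (stmt-BirchSwinnertonDyer-19271), TOWER road, the
# GOOD-ORDINARY local tower kernels at `v ∣ 2` at FULL `2`-power depth: BRICK B, part 1 — the inflated cocycle of a
# `p^k`-torsion coinvariant class

HONEST FRAMING (cell `bsd-2adic`, run/shared/lean/pub/bsd-2adic/, seat `bsd-2adic-tower-1` GEN 20, HUMAN RULINGS
D-0036 / D-0054 / D-0074): TOOL theorems only (no definition, no named fact, no `sorry`); closes nothing by itself;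
nothing booked; BSD is not proved by any of this. Brick B of the programme «UNIFORM layer bound
`∃ C, ∀ n, #𝒦_{v,n}[2^∞] ≤ C` at a good ordinary `2` over `ℚ`» ⇒ `WeierstrassCurve.Greenberg1999_kerG_bounded` at `p = 2`
⇒ Mazur's control theorem `WeierstrassCurve.selmer_control` over `ℚ` at `p = 2` (Greenberg, LNM 1716, Thm. 1.2). It is
the depth-`p^k` form of GEN 11's BRICKS G2/G3 (`…GoodOrdTowerCoinvCocycle.lean`, `…GoodOrdTowerCoinvKummer.lean`), whose
depth-`p` form used that `Ê[p]` is fixed by `Γ` (automatic at `p = 2`); at depth `p^k`, `k ≥ 2`, the torsion `Ê[p^k]` is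
NOT Galois-trivial, so the crossed homomorphisms become genuine continuous `1`-cocycles of the discrete `H_n`-module
`Z ≅ Ê[p^k]` and the count is against `#H¹(H_n, Z)` (Mathlib's continuous cohomology of `discreteTopRep H_n Z`).
Setting (as in G2/G3): `p` any prime, `κ` cyclotomic, `v ∋ p`, `K = ℚ_v`, `Γ = Gal(K̄/K)`, `H_n`, `H_∞`, `E(K̄_v) = localPoints W K`,
`g ∈ H_n` a topological generator modulo `H_∞`, `A₁ ≤ E(K̄_v)` a `Γ`-stable subgroup (`E₁(K̄_v) = Ê(𝔪̄)`).

* `exists_contOneCocycles_inflate_pow` — G2 at depth `p^k`: for `x ∈ A₁`, `y` fixed by `H_∞` with `p^k x = g y − y`, if the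
  `p^k`-torsion of `A₁` is fixed pointwise by some layer group `H_{m₀}` (finite level — `Ê[p^k]` is finite), there is a
  continuous `1`-cocycle `c` of `H_n` with values in `A₁`, vanishing on `H_∞`, `c(g) = x`, `p^k c(σ) = σ y − y`.
* `natCard_torsionBy_coinv_mul_card_quotient_le_card_H1` — G3 at depth `p^k`: with `M₁ = A₁ ∩ E(K̄_v)^{H_∞}`, `D₁ = g − 1`,
  `Aₙ = A₁ ∩ E(K̄_v)^{H_n}`, `A₁` `p^k`-divisible, and `Z` a discrete `Γ`-module mapped by an injective EQUIVARIANT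
  `ιZ : Z → E(K̄_v)` onto `A₁[p^k]`: if `H¹(H_n, Z)` is finite then `#(M₁/D₁M₁)[p^k] · #(Aₙ/p^k Aₙ) ≤ #H¹(H_n, Z)` (with
  finiteness). Proof as G3 but in `H¹`: the Kummer map `Aₙ → H¹(H_n, Z)`, `b ↦ [∂b̃]` (`p^k b̃ = b`; the class does not
  depend on the root), has kernel `p^k Aₙ`; `[x] ↦ [c − ∂ỹ] mod κ(Aₙ)` is injective (`χ − χ' = κ(b) + ∂t` forces
  `a = ỹ' − ỹ − b̃ − t ∈ M₁` on `H_∞` and `x − x' = (g − 1)(−a)` at `g`).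

References: R. Greenberg, LNM 1716 (1999), §3 Lemma 3.1 (p. 86), Lemma 3.4 (p. 89) with Prop. 2.5 (p. 80); J.-P. Serre,
*Local Fields*, XIII §1 Prop. 1; J. Silverman, *AEC* VIII §2 (Kummer pairing).
-/

set_option autoImplicit false
-- the Theorems namespace of this sub repeats the summit name by design (D-0017 nested layout: Summit.<S>.<Sub>)
set_option linter.dupNamespace false

noncomputable section

open scoped Classical

universe u

namespace Summit.BirchSwinnertonDyer.BirchSwinnertonDyer.Theorems.GoodOrdTower

open NumberField IsDedekindDomain Field PadicInt Literature.NumberTheory.EllipticCurves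
  Literature.NumberTheory.GaloisRepresentations WeierstrassCurve

variable {p : ℕ} [Fact p.Prime] {κ : ZpExtension ℚ p}

/-! ### The inflated cocycle of a `p^k`-torsion coinvariant class -/

/-- **The inflated cocycle of a `p^k`-torsion coinvariant class** (BRICK G2 at depth `p^k`). Let `A₁ ≤ E(K̄_v)` be a
`Γ`-stable subgroup whose `p^k`-torsion elements are fixed by the layer group `H_{m₀}` (a finite level: `Ê[p^k]` is finite),
`g ∈ H_n` a topological generator of `H_n` modulo `H_∞`, and `x ∈ A₁`, `y ∈ E(K̄_v)` fixed by `H_∞` with `p^k x = g y − y`.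
Then there is a continuous `1`-cocycle `c` of `H_n` with values in `E(K̄_v)` vanishing on `H_∞`, with `c(g) = x`,
`c(σ) ∈ A₁` and `p^k c(σ) = σ y − y` for every `σ ∈ H_n`. Construction as in G2: `x`, `y` and `A₁[p^k]` are fixed by some
`H_{n+R₀}`; the geometric sums `S_i(x) = Σ_{j<i} g^j x` satisfy `S_{p^{R₀+k}}(x) = p^k S_{p^{R₀}}(x) = 0`
(`p^k S_{p^{R₀}}(x) = g^{p^{R₀}} y − y = 0`, so `S_{p^{R₀}}(x) ∈ A₁[p^k]` is fixed by `g^{p^{R₀}}`), hence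
`σ = g^i h ↦ S_i(x)` (`h ∈ H_{n+R₀+k}`) is a cocycle of the cyclic quotient `H_n/H_{n+R₀+k}`, inflated to `H_n`.
[cite: GreenbergLNM1716, §3 Lemma 3.1 (p. 86)] [cite: SerreLocalFields1979, XIII §1 Prop. 1] -/
theorem exists_contOneCocycles_inflate_pow (hκ : κ.IsCyclotomic) (v : HeightOneSpectrum (𝓞 ℚ))
    (hv : ((p : ℕ) : 𝓞 ℚ) ∈ v.asIdeal) (W : WeierstrassCurve ℚ) (n k m₀ : ℕ)
    {g : absoluteGaloisGroup (v.adicCompletion ℚ)}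
    (hg : g ∈ localSubgroup (κ.layerSubgroup n) (v.adicCompletion ℚ))
    (hgen : ∀ U : Subgroup (absoluteGaloisGroup (v.adicCompletion ℚ)),
      IsOpen (U : Set (absoluteGaloisGroup (v.adicCompletion ℚ))) →
        localSubgroup κ.kerSubgroup (v.adicCompletion ℚ) ≤ U → g ∈ U →
          localSubgroup (κ.layerSubgroup n) (v.adicCompletion ℚ) ≤ U)
    (A₁ : AddSubgroup (localPoints W (v.adicCompletion ℚ)))
    (hstab : ∀ (σ : absoluteGaloisGroup (v.adicCompletion ℚ)) (a : localPoints W (v.adicCompletion ℚ)),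
      a ∈ A₁ → σ • a ∈ A₁)
    (hZ : ∀ a ∈ A₁, p ^ k • a = 0 → ∀ h ∈ localSubgroup (κ.layerSubgroup m₀) (v.adicCompletion ℚ), h • a = a)
    {x y : localPoints W (v.adicCompletion ℚ)} (hx : x ∈ A₁)
    (hxi : ∀ h ∈ localSubgroup κ.kerSubgroup (v.adicCompletion ℚ), h • x = x)
    (hyi : ∀ h ∈ localSubgroup κ.kerSubgroup (v.adicCompletion ℚ), h • y = y)
    (hrel : p ^ k • x = g • y - y) :
    ∃ c : contOneCocycles (discreteTopRep (localSubgroup (κ.layerSubgroup n) (v.adicCompletion ℚ))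
      (localPoints W (v.adicCompletion ℚ))),
      (∀ σ : localSubgroup (κ.layerSubgroup n) (v.adicCompletion ℚ),
        (σ : absoluteGaloisGroup (v.adicCompletion ℚ)) ∈ localSubgroup κ.kerSubgroup (v.adicCompletion ℚ) →
          c.1 σ = 0) ∧
      c.1 ⟨g, hg⟩ = x ∧
      (∀ σ : localSubgroup (κ.layerSubgroup n) (v.adicCompletion ℚ), c.1 σ ∈ A₁) ∧
      (∀ σ : localSubgroup (κ.layerSubgroup n) (v.adicCompletion ℚ),
        p ^ k • c.1 σ = (σ : absoluteGaloisGroup (v.adicCompletion ℚ)) • y - y) := by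
  -- notation (`let`, not `set`: no context rewriting)
  let K := v.adicCompletion ℚ
  let P : Type := localPoints W K
  let Hn : Subgroup (absoluteGaloisGroup K) := localSubgroup (κ.layerSubgroup n) K
  let X : TopRep ℤ Hn := discreteTopRep Hn P
  let γ : Hn := ⟨g, hg⟩
  have hXρ : ∀ (σ : Hn) (m : P), X.ρ σ m = (σ : absoluteGaloisGroup K) • m := fun _ _ ↦ rfl
  have hXρpow : ∀ (j : ℕ) (m : P), X.ρ (γ ^ j) m = (g ^ j) • m := fun j m ↦ by
    rw [hXρ, SubgroupClass.coe_pow]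
  -- `κ(res g) = p^n u`
  obtain ⟨u, hu⟩ := MultTowerSP1.exists_units_kappa_resGal_eq_of_generate hκ v hv n hg hgen
  have hgi : ∀ (R i : ℕ), g ^ i ∈ localSubgroup (κ.layerSubgroup (n + R)) K ↔ p ^ R ∣ i := fun R i ↦
    MultTowerSP1.pow_mem_localSubgroup_layerSubgroup_iff (κ := κ) v n R hu i
  -- a common finite level `n + R₀` for `x`, `y` and the `p^k`-torsion of `A₁`
  obtain ⟨m₁, hm₁⟩ := exists_forall_mem_localSubgroup_layerSubgroup_smul_point_eq (κ := κ) v W x hxi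
  obtain ⟨m₂, hm₂⟩ := exists_forall_mem_localSubgroup_layerSubgroup_smul_point_eq (κ := κ) v W y hyi
  obtain ⟨R₀, hxR₀, hyR₀, hZR₀⟩ : ∃ R₀ : ℕ, (∀ h ∈ localSubgroup (κ.layerSubgroup (n + R₀)) K, h • x = x) ∧
      (∀ h ∈ localSubgroup (κ.layerSubgroup (n + R₀)) K, h • y = y) ∧
      (∀ a ∈ A₁, p ^ k • a = 0 → ∀ h ∈ localSubgroup (κ.layerSubgroup (n + R₀)) K, h • a = a) :=
    ⟨max (max m₁ m₂) m₀,
      fun h hh ↦ hm₁ h (MultTowerSP1.localSubgroup_layerSubgroup_antitone κ K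
        (((le_max_left m₁ m₂).trans (le_max_left _ m₀)).trans (Nat.le_add_left _ n)) hh),
      fun h hh ↦ hm₂ h (MultTowerSP1.localSubgroup_layerSubgroup_antitone κ K
        (((le_max_right m₁ m₂).trans (le_max_left _ m₀)).trans (Nat.le_add_left _ n)) hh),
      fun a ha hpa h hh ↦ hZ a ha hpa h (MultTowerSP1.localSubgroup_layerSubgroup_antitone κ K
        ((le_max_right _ m₀).trans (Nat.le_add_left _ n)) hh)⟩
  have hleR : localSubgroup (κ.layerSubgroup (n + (R₀ + k))) K ≤ localSubgroup (κ.layerSubgroup (n + R₀)) K :=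
    MultTowerSP1.localSubgroup_layerSubgroup_antitone κ K (by omega)
  have hxR : ∀ h ∈ localSubgroup (κ.layerSubgroup (n + (R₀ + k))) K, h • x = x := fun h hh ↦ hxR₀ h (hleR hh)
  have hyR : ∀ h ∈ localSubgroup (κ.layerSubgroup (n + (R₀ + k))) K, h • y = y := fun h hh ↦ hyR₀ h (hleR hh)
  -- the open normal subgroup `H = H_{n+R₀+k} ∩ H_n` of `H_n` and the cyclic quotient `H_n / H = ⟨ḡ⟩`
  have hnormal : (localSubgroup (κ.layerSubgroup (n + (R₀ + k))) K).Normal := by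
    rw [localSubgroup_eq_comap]; exact Subgroup.Normal.comap inferInstance _
  let H : Subgroup Hn := (localSubgroup (κ.layerSubgroup (n + (R₀ + k))) K).subgroupOf Hn
  haveI hHnormal : H.Normal := Subgroup.normal_subgroupOf
  have hmemH : ∀ σ : Hn, σ ∈ H ↔
      (σ : absoluteGaloisGroup K) ∈ localSubgroup (κ.layerSubgroup (n + (R₀ + k))) K :=
    fun σ ↦ Subgroup.mem_subgroupOf
  have hHopen : IsOpen (H : Set Hn) :=
    (MultTowerNS2.isOpen_localSubgroup _ (κ.isOpen_layerSubgroup (n + (R₀ + k))) K).preimage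
      continuous_subtype_val
  have hgenQ : ∀ q : Hn ⧸ H, ∃ i : ℕ, q = (QuotientGroup.mk γ : Hn ⧸ H) ^ i := by
    intro q
    obtain ⟨σ, rfl⟩ := QuotientGroup.mk_surjective q
    obtain ⟨i, -, hi⟩ := exists_pow_inv_mul_mem_localSubgroup_layerSubgroup (κ := κ) v n (R₀ + k) hu σ.2
    refine ⟨i, ?_⟩
    rw [← QuotientGroup.mk_pow, eq_comm, QuotientGroup.eq, hmemH]
    simpa only [Subgroup.coe_mul, Subgroup.coe_inv, SubgroupClass.coe_pow] using hi
  -- the order of `ḡ` is `p^(R₀+k)`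
  have hord : orderOf (QuotientGroup.mk γ : Hn ⧸ H) = p ^ (R₀ + k) := by
    have key : ∀ i : ℕ, (QuotientGroup.mk γ : Hn ⧸ H) ^ i = 1 ↔ p ^ (R₀ + k) ∣ i := fun i ↦ by
      rw [← QuotientGroup.mk_pow, QuotientGroup.eq_one_iff, hmemH, SubgroupClass.coe_pow]
      exact hgi (R₀ + k) i
    exact Nat.dvd_antisymm (orderOf_dvd_of_pow_eq_one ((key _).mpr dvd_rfl)) ((key _).mp (pow_orderOf_eq_one _))
  -- every `S_i(x)` lies in `A₁`
  have hSA : ∀ i : ℕ, geomSum (X := X) γ x i ∈ A₁ := fun i ↦ by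
    induction i with
    | zero => rw [geomSum_zero]; exact A₁.zero_mem
    | succ i ih => rw [geomSum_succ, hXρpow]; exact A₁.add_mem ih (hstab _ _ hx)
  -- the norm vanishes: `S_{p^(R₀+k)}(x) = 0`
  have hN : geomSum (X := X) γ x (orderOf (QuotientGroup.mk γ : Hn ⧸ H)) = 0 := by
    rw [hord]
    -- `p^k • S_{p^{R₀}}(x) = g^{p^{R₀}} y - y = 0`
    have hgR₀ : g ^ p ^ R₀ ∈ localSubgroup (κ.layerSubgroup (n + R₀)) K := (hgi R₀ _).mpr dvd_rfl
    have hpS : p ^ k • geomSum (X := X) γ x (p ^ R₀) = 0 := by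
      rw [← geomSum_nsmul (X := X), hrel, ← hXρ γ y, geomSum_smul_sub_eq (X := X), hXρpow, hyR₀ _ hgR₀,
        sub_self]
    -- hence `S_{p^{R₀}}(x) ∈ A₁[p^k]` is fixed by `g^{p^{R₀}}`, and `S_{p^{R₀+k}}(x) = p^k • S_{p^{R₀}}(x)`
    have hfix : X.ρ (γ ^ p ^ R₀) (geomSum (X := X) γ x (p ^ R₀)) = geomSum (X := X) γ x (p ^ R₀) := by
      rw [hXρpow]; exact hZR₀ _ (hSA _) hpS _ hgR₀
    rw [pow_add, geomSum_mul_eq_nsmul_of_apply_eq (X := X) γ x hfix (p ^ k), hpS]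
  -- translates of `x` are fixed by `H_{n+R₀+k}` (normality), hence so are the sums `S_i(x)`
  have hfixS : ∀ h ∈ localSubgroup (κ.layerSubgroup (n + (R₀ + k))) K,
      ∀ i : ℕ, h • geomSum (X := X) γ x i = geomSum (X := X) γ x i := by
    intro h hh i
    induction i with
    | zero => rw [geomSum_zero, smul_zero]
    | succ i ih =>
      rw [geomSum_succ, smul_add, ih, hXρpow]
      congr 1
      have hconj : (g ^ i)⁻¹ * h * (g ^ i) ∈ localSubgroup (κ.layerSubgroup (n + (R₀ + k))) K := by
        have := hnormal.conj_mem h hh (g ^ i)⁻¹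
        rwa [inv_inv] at this
      calc h • (g ^ i) • x = (g ^ i) • (((g ^ i)⁻¹ * h * g ^ i) • x) := by
            rw [← mul_smul, ← mul_smul]; congr 1; group
        _ = (g ^ i) • x := by rw [hxR _ hconj]
  -- the cocycle `σ = g^i h ↦ S_i(x)`
  let f : Hn → P := fun σ ↦ geomSum (X := X) γ x (idxQ H γ hgenQ (σ : Hn ⧸ H))
  have hf_cont : Continuous f := by
    haveI : DiscreteTopology (Hn ⧸ H) := QuotientGroup.discreteTopology hHopen
    have hc : Continuous (fun q : Hn ⧸ H ↦ geomSum (X := X) γ x (idxQ H γ hgenQ q)) :=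
      continuous_of_discreteTopology
    exact hc.comp QuotientGroup.continuous_mk
  -- `σ = g^{idx σ} · h` with `h ∈ H_{n+R₀+k}`
  have hdec : ∀ σ : Hn, ((g ^ idxQ H γ hgenQ (σ : Hn ⧸ H))⁻¹ * (σ : absoluteGaloisGroup K)) ∈
      localSubgroup (κ.layerSubgroup (n + (R₀ + k))) K := fun σ ↦ by
    have hh := pow_idxQ_inv_mul_mem H γ hgenQ σ
    rw [hmemH] at hh
    simpa only [Subgroup.coe_mul, Subgroup.coe_inv, SubgroupClass.coe_pow] using hh
  have hsplit : ∀ (σ : Hn) (m : P), (σ : absoluteGaloisGroup K) • m =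
      (g ^ idxQ H γ hgenQ (σ : Hn ⧸ H)) • ((g ^ idxQ H γ hgenQ (σ : Hn ⧸ H))⁻¹ * (σ : absoluteGaloisGroup K)) • m :=
    fun σ m ↦ by rw [← mul_smul, mul_inv_cancel_left]
  let c : contOneCocycles X := ⟨⟨f, hf_cont⟩, fun σ τ ↦ by
    change geomSum (X := X) γ x (idxQ H γ hgenQ ((σ * τ : Hn) : Hn ⧸ H)) =
      geomSum (X := X) γ x (idxQ H γ hgenQ (σ : Hn ⧸ H)) +
        X.ρ σ (geomSum (X := X) γ x (idxQ H γ hgenQ (τ : Hn ⧸ H)))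
    rw [geomSum_eq_of_modEq (X := X) γ x hN (idxQ_mul_modEq H γ hgenQ σ τ), geomSum_add, hXρ σ, hsplit σ,
      hfixS _ (hdec σ), hXρpow]⟩
  have hc_apply : ∀ σ : Hn, c.1 σ = geomSum (X := X) γ x (idxQ H γ hgenQ (σ : Hn ⧸ H)) := fun _ ↦ rfl
  refine ⟨c, fun σ hσ ↦ ?_, ?_, fun σ ↦ by rw [hc_apply]; exact hSA _, fun σ ↦ ?_⟩
  · -- vanishing on `H_∞ ⊆ H_{n+R₀+k}`: `idx σ ≡ 0`
    rw [hc_apply]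
    have hσH : σ ∈ H := by
      rw [hmemH, mem_localSubgroup_iff]
      exact κ.kerSubgroup_le_layerSubgroup (n + (R₀ + k)) ((mem_localSubgroup_iff _ _ _).mp hσ)
    have h1 : (σ : Hn ⧸ H) = 1 := (QuotientGroup.eq_one_iff σ).mpr hσH
    have h0 : idxQ H γ hgenQ (σ : Hn ⧸ H) ≡ 0 [MOD orderOf (QuotientGroup.mk γ : Hn ⧸ H)] := by
      rw [← pow_eq_pow_iff_modEq, pow_zero, ← idxQ_spec H γ hgenQ (σ : Hn ⧸ H), h1]
    rw [geomSum_eq_of_modEq (X := X) γ x hN h0, geomSum_zero]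
  · -- `c(g) = S_1(x) = x`
    rw [hc_apply]
    have h1 : idxQ H γ hgenQ (γ : Hn ⧸ H) ≡ 1 [MOD orderOf (QuotientGroup.mk γ : Hn ⧸ H)] := by
      rw [← pow_eq_pow_iff_modEq, pow_one]
      exact (idxQ_spec H γ hgenQ (γ : Hn ⧸ H)).symm
    rw [geomSum_eq_of_modEq (X := X) γ x hN h1, geomSum_one]
  · -- `p^k • S_i(x) = S_i(g y - y) = g^i y - y = σ y - y`
    rw [hc_apply, ← geomSum_nsmul (X := X), hrel, ← hXρ γ y, geomSum_smul_sub_eq (X := X), hXρpow,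
      hsplit σ y, hyR _ (hdec σ)]

end Summit.BirchSwinnertonDyer.BirchSwinnertonDyer.Theorems.GoodOrdTower

end
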